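import Summits.AtomisticToContinuum.HydrodynamicLimit.Theorems.JParityClosureRateFloorPairFunctionalUpperRung0
import Summits.AtomisticToContinuum.HydrodynamicLimit.Theorems.JParityClosureRateFloorPairFunctionalRung0Integrability
import Summits.AtomisticToContinuum.HydrodynamicLimit.Theorems.JParityClosureRateFloorMarkovFlowTransfer
import HarnessLib

/-!
# The B-side of `RateFloor` at rung 0, V: the in-probability UPPER bound for the time-integrated, χ-weighted pair functional of a
# GENERAL nonnegative mark along the flow (helper file, `--supports stmt-AtomisticToContinuum-13080`)

Crux `JParityClosure.RateFloor` (stmt-AtomisticToContinuum-13080), line `Sketch`, rung-0 stub `stub_staticOpacityFloorRung0` — its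
B-side input, in the crux's own terms: for constant profiles `(a, u, θ)` at small reduced density, every family of flows `Φ_N`, every
`τ > 0`, continuous `0 ≤ χ`, continuous `0 ≤ Ξ ≤ C`, `0 < r < 1/2`, `η, δ > 0`, eventually in `N`

  `G_N {z | Θ̄_Ξ ∫₀^τ∫ χ + η < ∫₀^τ ∫ χ(s, x) B_r Ξ (Φ_s z, x) dx ds} ≤ δ`      (`pairFunctional_upper_inProb_rung0`),

`Θ̄_Ξ = ∫ Θ Ξ d(N(u,θ) ⊗ N(u,θ))`, `B_r Ξ (z, x) = pairFunctional r Ξ z x` (verbatim the crux's `B Ξ z s x` at `z ↦ Φ_s z`).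
Ingredients: the static `L¹` bound `integral_abs_pairFunctional_sub_le` (file IV), made uniform in `x₀` by the translation invariance of
`P_N` (`integral_sq_empDensity_sub_one_eq`), integrated against `χ(s, ·)` (Fubini), and the one-sided Markov transfer along the flow
`measure_lt_setIntegral_flow_le_of_nonneg` (Gibbs invariance); `V_N → 0` (`tendsto_integral_sq_empDensity_sub_one`).
-/

noncomputable section

open MeasureTheory ProbabilityTheory Set Filter Topology
open scoped ENNReal InnerProductSpace BigOperators

namespace Summit.AtomisticToContinuum.HydrodynamicLimit.Theorems

namespace RateFloorPairFunctionalUpper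

open Literature.Analysis.FluidPDE Literature.MathematicalPhysics.KineticTheory
open Literature.Probability.Moments
open Summit.AtomisticToContinuum.HydrodynamicLimit.Theorems.EvenStressEnskog
open RateFloorMarkovFlowTransfer

/-! ## The χ-weighted deviation functional: continuity, its static mean, and the transfer along the flow -/

/-- The χ-weighted deviation functional `(s, z) ↦ ∫ χ(s, x) |B_r Ξ (z, x) − c| dx` is jointly continuous (parametric integral of a
jointly continuous integrand over the compact torus). [folklore] -/
theorem continuous_devFunctional {N : ℕ} (r : ℝ) {Ξ : V3 × V3 × V3 → ℝ} (hΞc : Continuous Ξ)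
    {χ : ℝ × T3 → ℝ} (hχ : Continuous χ) (c : ℝ) :
    Continuous fun p : ℝ × Config (N + 1) (Fin 3) T3 => ∫ x : T3, χ (p.1, x) * |pairFunctional r Ξ p.2 x - c| := by
  have hF : Continuous (Function.uncurry fun (p : ℝ × Config (N + 1) (Fin 3) T3) (x : T3) =>
      χ (p.1, x) * |pairFunctional r Ξ p.2 x - c|) := by
    have h1 : Continuous fun q : (ℝ × Config (N + 1) (Fin 3) T3) × T3 => χ (q.1.1, q.2) :=
      hχ.comp (continuous_fst.fst.prodMk continuous_snd)
    have h2 : Continuous fun q : (ℝ × Config (N + 1) (Fin 3) T3) × T3 => pairFunctional r Ξ q.1.2 q.2 :=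
      continuous_pairFunctional_comp r hΞc continuous_fst.snd continuous_snd
    exact h1.mul ((h2.sub continuous_const).abs)
  have h := continuous_parametric_integral_of_continuous (μ := (volume : Measure T3)) hF isCompact_univ
  simpa only [Measure.restrict_univ] using h

/-- **The static mean of the deviation functional**: if `E_G|B_r Ξ (·, x₀) − c| ≤ e` for every base point and `0 ≤ χ(s, ·) ≤ C_χ`,
then `∫⁻ ofReal (∫ χ(s, x)|B_r Ξ (z, x) − c| dx) dG ≤ ofReal (C_χ e)` (Tonelli over `G × 𝕋³`). [folklore] -/
theorem lintegral_devFunctional_le {σ a θ : ℝ} {u : V3} (hσ2 : σ ≤ 1 / 2) (ha : 0 < a) (hθ : 0 < θ)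
    {Ξ : V3 × V3 × V3 → ℝ} (hΞc : Continuous Ξ) (hΞ0 : ∀ q, 0 ≤ Ξ q) {C : ℝ} (hΞC : ∀ q, Ξ q ≤ C)
    {r : ℝ} (hr : 0 < r) (N : ℕ) (Φ : HardSphereFlow (Torus.geometry (Fin 3)) (hsDiameter σ N) (N + 1))
    {χ : ℝ × T3 → ℝ} (hχ : Continuous χ) (s : ℝ) (hχ0 : ∀ x, 0 ≤ χ (s, x)) {Cχ : ℝ} (hχC : ∀ x, χ (s, x) ≤ Cχ)
    (c : ℝ) {e : ℝ}
    (he : ∀ x₀ : T3, ∫ z, |pairFunctional r Ξ z x₀ - c| ∂(localGibbsLaw σ (fun _ => a) (fun _ => u) (fun _ => θ) N Φ) ≤ e) :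
    ∫⁻ z, ENNReal.ofReal (∫ x : T3, χ (s, x) * |pairFunctional r Ξ z x - c|)
        ∂(localGibbsLaw σ (fun _ => a) (fun _ => u) (fun _ => θ) N Φ) ≤ ENNReal.ofReal (Cχ * e) := by
  set G := localGibbsLaw σ (fun _ => a) (fun _ => u) (fun _ => θ) N Φ with hG
  haveI : IsProbabilityMeasure G := isProbabilityMeasure_localGibbsLaw continuous_const continuous_const continuous_const
    (fun _ => ha) (fun _ => hθ) hσ2 N Φ
  have hCχ0 : 0 ≤ Cχ := (hχ0 0).trans (hχC 0)
  have he0 : 0 ≤ e := (integral_nonneg fun z => abs_nonneg _).trans (he 0)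
  -- continuity in `x` of the two integrands, for fixed `z`
  have hcont : ∀ z : Config (N + 1) (Fin 3) T3, Continuous fun x : T3 => |pairFunctional r Ξ z x - c| := fun z =>
    ((continuous_pairFunctional_comp r hΞc continuous_const continuous_id).sub continuous_const).abs
  have hint : ∀ z : Config (N + 1) (Fin 3) T3, Integrable (fun x : T3 => |pairFunctional r Ξ z x - c|) volume := fun z =>
    (hcont z).integrable_of_hasCompactSupport (isClosed_tsupport _).isCompact
  have hintχ : ∀ z : Config (N + 1) (Fin 3) T3, Integrable (fun x : T3 => χ (s, x) * |pairFunctional r Ξ z x - c|) volume :=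
    fun z => ((hχ.comp (Continuous.prodMk_right s)).mul (hcont z)).integrable_of_hasCompactSupport (isClosed_tsupport _).isCompact
  -- pointwise: `∫ χ |…| ≤ Cχ ∫ |…|`
  have hpt : ∀ z, ∫ x : T3, χ (s, x) * |pairFunctional r Ξ z x - c| ≤ Cχ * ∫ x : T3, |pairFunctional r Ξ z x - c| := fun z => by
    rw [← integral_const_mul]
    exact integral_mono (hintχ z) ((hint z).const_mul _) fun x => mul_le_mul_of_nonneg_right (hχC x) (abs_nonneg _)
  -- joint measurability (from measurable building blocks: the pair functional is a finite double sum)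
  have hjm : Measurable fun q : Config (N + 1) (Fin 3) T3 × T3 => ENNReal.ofReal |pairFunctional r Ξ q.1 q.2 - c| := by
    have hpf : Measurable fun q : Config (N + 1) (Fin 3) T3 × T3 => pairFunctional r Ξ q.1 q.2 := by
      simp only [pairFunctional_eq_sum]
      refine measurable_const.mul (Finset.measurable_sum _ fun i _ => Finset.measurable_sum _ fun j _ => ?_)
      have hi : Measurable fun q : Config (N + 1) (Fin 3) T3 × T3 => (q.1 i).1 := ((measurable_pi_apply i).comp measurable_fst).fst
      have hj : Measurable fun q : Config (N + 1) (Fin 3) T3 × T3 => (q.1 j).1 := ((measurable_pi_apply j).comp measurable_fst).fst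
      have hvi : Measurable fun q : Config (N + 1) (Fin 3) T3 × T3 => (q.1 i).2 := ((measurable_pi_apply i).comp measurable_fst).snd
      have hvj : Measurable fun q : Config (N + 1) (Fin 3) T3 × T3 => (q.1 j).2 := ((measurable_pi_apply j).comp measurable_fst).snd
      exact ((measurable_coneKernel_comp r hi measurable_snd).mul (measurable_coneKernel_comp r hj measurable_snd)).mul
        ((continuous_sphereMark hΞc).measurable.comp (hvi.prodMk hvj))
    exact ((hpf.sub measurable_const).abs).ennreal_ofReal
  set F : Config (N + 1) (Fin 3) T3 → T3 → ℝ≥0∞ := fun z x => ENNReal.ofReal |pairFunctional r Ξ z x - c| with hF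
  have hFm : Measurable (Function.uncurry F) := hjm
  have hstep1 : ∀ z, ENNReal.ofReal (∫ x : T3, χ (s, x) * |pairFunctional r Ξ z x - c|) ≤ ENNReal.ofReal Cχ * ∫⁻ x : T3, F z x := by
    intro z
    refine (ENNReal.ofReal_le_ofReal (hpt z)).trans (le_of_eq ?_)
    rw [ENNReal.ofReal_mul hCχ0, ofReal_integral_eq_lintegral_ofReal (hint z) (ae_of_all _ fun x => abs_nonneg _)]
  have hstep2 : ∀ x : T3, ∫⁻ z, F z x ∂G ≤ ENNReal.ofReal e := by
    intro x
    have h := ofReal_integral_eq_lintegral_ofReal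
      (integrable_abs_pairFunctional_sub_rung0 (u := u) hσ2 ha hθ hΞc hΞ0 hΞC hr x N Φ c) (ae_of_all _ fun z => abs_nonneg _)
    simp only [hF]
    rw [← h]
    exact ENNReal.ofReal_le_ofReal (he x)
  calc ∫⁻ z, ENNReal.ofReal (∫ x : T3, χ (s, x) * |pairFunctional r Ξ z x - c|) ∂G
      ≤ ∫⁻ z, (ENNReal.ofReal Cχ * ∫⁻ x : T3, F z x) ∂G := lintegral_mono hstep1
    _ = ENNReal.ofReal Cχ * ∫⁻ z, (∫⁻ x : T3, F z x) ∂G := lintegral_const_mul _ hFm.lintegral_prod_right'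
    _ = ENNReal.ofReal Cχ * ∫⁻ x : T3, ∫⁻ z, F z x ∂G := by rw [lintegral_lintegral_swap hFm.aemeasurable]
    _ ≤ ENNReal.ofReal Cχ * ∫⁻ _x : T3, ENNReal.ofReal e := mul_le_mul' le_rfl (lintegral_mono hstep2)
    _ = ENNReal.ofReal (Cχ * e) := by
        rw [lintegral_const, measure_univ, mul_one, ← ENNReal.ofReal_mul hCχ0]

/-- **The B-side event along the flow, bounded by Markov** (rung 0): if `E_G|B_r Ξ (·, x₀) − Θ̄_Ξ| ≤ e` for every base point,
`0 ≤ χ ≤ C_χ` on `[0, τ] × 𝕋³`, `τ, η > 0`, then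
`G {z | Θ̄_Ξ ∫₀^τ∫χ + η < ∫₀^τ∫ χ(s,x) B_r Ξ (Φ_s z, x) dx ds} ≤ ofReal (τ C_χ e / η)`. [folklore] -/
theorem measure_timeIntegral_pairFunctional_gt_le {σ a θ : ℝ} {u : V3} (hσ2 : σ ≤ 1 / 2) (ha : 0 < a) (hθ : 0 < θ)
    {Ξ : V3 × V3 × V3 → ℝ} (hΞc : Continuous Ξ) (hΞ0 : ∀ q, 0 ≤ Ξ q) {C : ℝ} (hΞC : ∀ q, Ξ q ≤ C)
    {r : ℝ} (hr : 0 < r) (N : ℕ) (Φ : HardSphereFlow (Torus.geometry (Fin 3)) (hsDiameter σ N) (N + 1))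
    {χ : ℝ × T3 → ℝ} (hχ : Continuous χ) (hχ0 : ∀ p, 0 ≤ χ p) {τ η e Cχ : ℝ}
    (hχC : ∀ s ∈ Icc (0 : ℝ) τ, ∀ x, χ (s, x) ≤ Cχ) (hτ : 0 < τ) (hη : 0 < η)
    (he : ∀ x₀ : T3, ∫ z, |pairFunctional r Ξ z x₀ - ∫ p, sphereMark Ξ p.1 p.2 ∂((gaussMeasure u θ).prod (gaussMeasure u θ))|
      ∂(localGibbsLaw σ (fun _ => a) (fun _ => u) (fun _ => θ) N Φ) ≤ e) :
    localGibbsLaw σ (fun _ => a) (fun _ => u) (fun _ => θ) N Φ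
        {z | (∫ p, sphereMark Ξ p.1 p.2 ∂((gaussMeasure u θ).prod (gaussMeasure u θ))) *
              (∫ s in Icc (0 : ℝ) τ, ∫ x : T3, χ (s, x)) + η <
            ∫ s in Icc (0 : ℝ) τ, ∫ x : T3, χ (s, x) * pairFunctional r Ξ (Φ.flow s z) x} ≤
      ENNReal.ofReal (τ * (Cχ * e) / η) := by
  classical
  set G := localGibbsLaw σ (fun _ => a) (fun _ => u) (fun _ => θ) N Φ with hG
  set Θb : ℝ := ∫ p, sphereMark Ξ p.1 p.2 ∂((gaussMeasure u θ).prod (gaussMeasure u θ)) with hΘb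
  haveI : IsProbabilityMeasure G := isProbabilityMeasure_localGibbsLaw continuous_const continuous_const continuous_const
    (fun _ => ha) (fun _ => hθ) hσ2 N Φ
  have hΘb0 : 0 ≤ Θb := integral_nonneg fun p => sphereMark_nonneg' hΞ0 p.1 p.2
  -- the deviation functional
  set A : ℝ → Config (N + 1) (Fin 3) T3 → ℝ := fun s z => ∫ x : T3, χ (s, x) * |pairFunctional r Ξ z x - Θb| with hA
  have hAc : Continuous fun p : ℝ × Config (N + 1) (Fin 3) T3 => A p.1 p.2 := continuous_devFunctional r hΞc hχ Θb
  have hA0 : ∀ s z, 0 ≤ A s z := fun s z => integral_nonneg fun x => mul_nonneg (hχ0 _) (abs_nonneg _)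
  have hmean : ∀ t ∈ Icc (0 : ℝ) τ, ∫⁻ z, ENNReal.ofReal (A t z) ∂G ≤ ENNReal.ofReal (Cχ * e) := fun t ht =>
    lintegral_devFunctional_le (u := u) hσ2 ha hθ hΞc hΞ0 hΞC hr N Φ hχ t (fun x => hχ0 _) (hχC t ht) Θb he
  have hmarkov := measure_lt_setIntegral_flow_le_of_nonneg σ ha hθ u hσ2 N Φ hAc.measurable hA0 hτ hη hmean
  refine le_trans (measure_mono_ae ?_) hmarkov
  -- `G`-a.e. configuration is good; on good configurations the event forces `η < ∫ A_s (Φ_s z)`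
  have hgood : ∀ᵐ z ∂G, z ∈ Φ.good := by
    rw [hG, localGibbsLaw_eq]
    exact (localGibbsMeasure_absolutelyContinuous σ _ _ _ N Φ).ae_le Φ.ae_mem_good
  filter_upwards [hgood] with z hz hev
  -- the three time functions
  set f : ℝ → ℝ := fun s => ∫ x : T3, χ (s, x) * pairFunctional r Ξ (Φ.flow s z) x with hf
  set g : ℝ → ℝ := fun s => ∫ x : T3, χ (s, x) with hg
  set h : ℝ → ℝ := fun s => A s (Φ.flow s z) with hh
  -- pointwise in `s`: `f s - Θb * g s ≤ h s`
  have hx_int : ∀ s, Integrable (fun x : T3 => χ (s, x) * pairFunctional r Ξ (Φ.flow s z) x) volume := fun s =>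
    ((hχ.comp (Continuous.prodMk_right s)).mul
      (continuous_pairFunctional_comp r hΞc continuous_const continuous_id)).integrable_of_hasCompactSupport
        (isClosed_tsupport _).isCompact
  have hxg_int : ∀ s, Integrable (fun x : T3 => χ (s, x)) volume := fun s =>
    (hχ.comp (Continuous.prodMk_right s)).integrable_of_hasCompactSupport (isClosed_tsupport _).isCompact
  have hxa_int : ∀ s, Integrable (fun x : T3 => χ (s, x) * |pairFunctional r Ξ (Φ.flow s z) x - Θb|) volume := fun s =>
    ((hχ.comp (Continuous.prodMk_right s)).mul
      (((continuous_pairFunctional_comp r hΞc continuous_const continuous_id).sub continuous_const).abs)).integrable_of_hasCompactSupport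
        (isClosed_tsupport _).isCompact
  have hpt : ∀ s, f s - Θb * g s ≤ h s := fun s => by
    simp only [hf, hg, hh, hA]
    rw [← integral_const_mul, ← integral_sub (hx_int s) ((hxg_int s).const_mul Θb)]
    refine integral_mono ((hx_int s).sub ((hxg_int s).const_mul Θb)) (hxa_int s) fun x => ?_
    have e1 : χ (s, x) * pairFunctional r Ξ (Φ.flow s z) x - Θb * χ (s, x) = χ (s, x) * (pairFunctional r Ξ (Φ.flow s z) x - Θb) := by
      ring
    rw [e1]
    exact mul_le_mul_of_nonneg_left (le_abs_self _) (hχ0 _)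
  -- `h` is measurable and bounded on `[0, τ]`, hence integrable there; `g` is continuous
  have hflow_m : Measurable fun s : ℝ => Φ.flow s z := by
    have h1 : Measurable fun s : ℝ => Φ.good.piecewise (Φ.flow s) id z :=
      (measurable_piecewise_flow_torus Φ).comp (measurable_id.prodMk (measurable_const (a := z)))
    have e : (fun s : ℝ => Φ.good.piecewise (Φ.flow s) id z) = fun s : ℝ => Φ.flow s z := by
      funext s
      exact piecewise_flow_of_mem Φ s hz
    rwa [e] at h1
  have hhm : Measurable h := hAc.measurable.comp (measurable_id.prodMk hflow_m)
  have hCχ0 : 0 ≤ Cχ := (hχ0 (0, 0)).trans (hχC 0 ⟨le_rfl, hτ.le⟩ 0)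
  set Kz : ℝ := (3 / (Real.pi * r ^ 3)) ^ 2 * (C * (sphereMeasure : Measure (Metric.sphere (0 : V3) 1)).real univ) *
    (1 / 2 + 4 * ((((N + 1 : ℕ) : ℝ))⁻¹ * configEnergy z)) with hKz
  have hhb : ∀ s ∈ Icc (0 : ℝ) τ, |h s| ≤ Cχ * (Kz + Θb) := by
    intro s hs
    rw [abs_of_nonneg (hA0 _ _)]
    show ∫ x : T3, χ (s, x) * |pairFunctional r Ξ (Φ.flow s z) x - Θb| ≤ Cχ * (Kz + Θb)
    have hB : ∀ x : T3, |pairFunctional r Ξ (Φ.flow s z) x - Θb| ≤ Kz + Θb := fun x => by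
      refine (abs_sub _ _).trans (add_le_add ?_ (le_of_eq (abs_of_nonneg hΘb0)))
      rw [abs_of_nonneg (pairFunctional_nonneg hr hΞ0 _ _)]
      exact pairFunctional_flow_le_of_mem_good hr hΞc hΞ0 hΞC Φ hz s x
    calc ∫ x : T3, χ (s, x) * |pairFunctional r Ξ (Φ.flow s z) x - Θb|
        ≤ ∫ _x : T3, Cχ * (Kz + Θb) := integral_mono (hxa_int s) (integrable_const _) fun x =>
            mul_le_mul (hχC s hs x) (hB x) (abs_nonneg _) hCχ0
      _ = Cχ * (Kz + Θb) := by rw [integral_const, smul_eq_mul, probReal_univ, one_mul]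
  have hh_int : IntegrableOn h (Icc (0 : ℝ) τ) volume := by
    refine Measure.integrableOn_of_bounded (M := Cχ * (Kz + Θb)) (measure_Icc_lt_top.ne) hhm.aestronglyMeasurable ?_
    rw [ae_restrict_iff' measurableSet_Icc]
    exact ae_of_all _ fun s hs => by rw [Real.norm_eq_abs]; exact hhb s hs
  have hg_int : IntegrableOn g (Icc (0 : ℝ) τ) volume := by
    have hgc : Continuous g := by
      have hF : Continuous (Function.uncurry fun (s : ℝ) (x : T3) => χ (s, x)) := hχ
      have h := continuous_parametric_integral_of_continuous (μ := (volume : Measure T3)) hF isCompact_univ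
      simpa only [Measure.restrict_univ, hg] using h
    exact hgc.continuousOn.integrableOn_compact isCompact_Icc
  -- case split on the integrability of `f`
  by_cases hf_int : IntegrableOn f (Icc (0 : ℝ) τ) volume
  · have h1 : (∫ s in Icc (0 : ℝ) τ, f s) - Θb * ∫ s in Icc (0 : ℝ) τ, g s ≤ ∫ s in Icc (0 : ℝ) τ, h s := by
      rw [← integral_const_mul, ← integral_sub hf_int (hg_int.const_mul Θb)]
      exact integral_mono (hf_int.sub (hg_int.const_mul Θb)) hh_int hpt
    have hev' : Θb * (∫ s in Icc (0 : ℝ) τ, g s) + η < ∫ s in Icc (0 : ℝ) τ, f s := hev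
    show η < ∫ s in Icc (0 : ℝ) τ, h s
    linarith
  · exfalso
    have h0 : ∫ s in Icc (0 : ℝ) τ, f s = 0 := integral_undef hf_int
    have hev' : Θb * (∫ s in Icc (0 : ℝ) τ, g s) + η < ∫ s in Icc (0 : ℝ) τ, f s := hev
    rw [h0] at hev'
    have hg0 : 0 ≤ ∫ s in Icc (0 : ℝ) τ, g s := setIntegral_nonneg measurableSet_Icc fun s _ => integral_nonneg fun x => hχ0 _
    nlinarith [mul_nonneg hΘb0 hg0]

/-! ## The in-probability upper bound for the B-side, eventually in `N` -/

/-- A continuous weight is bounded on the compact slab `[0, τ] × 𝕋³`. [folklore] -/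
theorem exists_bound_on_slab' (χ : ℝ × T3 → ℝ) (hχ : Continuous χ) (τ : ℝ) :
    ∃ Cχ : ℝ, 0 ≤ Cχ ∧ ∀ s ∈ Icc (0 : ℝ) τ, ∀ x : T3, χ (s, x) ≤ Cχ := by
  have hK : IsCompact ((Icc (0 : ℝ) τ) ×ˢ (univ : Set T3)) := isCompact_Icc.prod isCompact_univ
  obtain ⟨Cχ, hC⟩ := hK.bddAbove_image hχ.continuousOn
  refine ⟨max Cχ 0, le_max_right _ _, fun s hs x => (le_max_left Cχ 0).trans' ?_⟩
  exact hC ⟨(s, x), ⟨hs, mem_univ _⟩, rfl⟩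

/-- Pure arithmetic of the four-term bound: with the tail `≤ ε₀/4`, the `η₂`-term `≤ ε₀/8`, `η₁/2 = ε₀/8` and the `N`-remainder
`< ε₀/4`, the four-term bound is `≤ ε₀`. [folklore] -/
theorem fourTerm_le_of_bounds {Mr Sr C m₂ L η₁ η₂ ν V ε₀ : ℝ} (hε₀ : 0 ≤ ε₀)
    (htail : 4 * Mr ^ 2 * (C * Sr / L) * m₂ + C * Sr / L * (4 * m₂) ≤ ε₀ / 4)
    (hT2 : C * (2 * L) * Sr * (Mr + 1) * η₂ ≤ ε₀ / 8) (hη₁ : η₁ / 2 = ε₀ / 8)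
    (hR : 8 * Mr ^ 4 * (C * (2 * L) * Sr) ^ 2 * ν / (2 * η₁) + C * (2 * L) * Sr * (Mr + 1) * (V / (4 * η₂)) +
      C * (2 * L) * Sr * Mr ^ 2 * ν < ε₀ / 4) :
    (η₁ / 2 + 8 * Mr ^ 4 * (C * (2 * L) * Sr) ^ 2 * ν / (2 * η₁)) +
      C * (2 * L) * Sr * ((Mr + 1) * (η₂ + V / (4 * η₂)) + Mr ^ 2 * ν) +
      4 * Mr ^ 2 * (C * Sr / L) * m₂ + C * Sr / L * (4 * m₂) ≤ ε₀ := by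
  have e : (η₁ / 2 + 8 * Mr ^ 4 * (C * (2 * L) * Sr) ^ 2 * ν / (2 * η₁)) +
      C * (2 * L) * Sr * ((Mr + 1) * (η₂ + V / (4 * η₂)) + Mr ^ 2 * ν) +
      4 * Mr ^ 2 * (C * Sr / L) * m₂ + C * Sr / L * (4 * m₂) =
      η₁ / 2 + (8 * Mr ^ 4 * (C * (2 * L) * Sr) ^ 2 * ν / (2 * η₁) + C * (2 * L) * Sr * (Mr + 1) * (V / (4 * η₂)) +
        C * (2 * L) * Sr * Mr ^ 2 * ν) + C * (2 * L) * Sr * (Mr + 1) * η₂ +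
        (4 * Mr ^ 2 * (C * Sr / L) * m₂ + C * Sr / L * (4 * m₂)) := by ring
  rw [e]
  linarith

/-- The `N`-remainder of the four-term bound tends to `0` (`V_N → 0`, `(N+1)⁻¹ → 0`). [folklore] -/
theorem tendsto_remainder {V : ℕ → ℝ} (hV : Tendsto V atTop (𝓝 0)) (c₁ c₂ c₃ η₁ η₂ : ℝ) :
    Tendsto (fun N : ℕ => c₁ * (((N + 1 : ℕ) : ℝ))⁻¹ / (2 * η₁) + c₂ * (V N / (4 * η₂)) + c₃ * (((N + 1 : ℕ) : ℝ))⁻¹)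
      atTop (𝓝 0) := by
  have hn : Tendsto (fun N : ℕ => (((N + 1 : ℕ) : ℝ))⁻¹) atTop (𝓝 0) :=
    tendsto_inv_atTop_zero.comp ((tendsto_natCast_atTop_atTop (R := ℝ)).comp (tendsto_add_atTop_nat 1))
  have h := (((hn.const_mul c₁).div_const (2 * η₁)).add ((hV.div_const (4 * η₂)).const_mul c₂)).add (hn.const_mul c₃)
  simpa using h

/-- **The B-side of `RateFloor` at rung 0, in probability.**  For constant profiles `a, θ > 0`, `u`, at small reduced density
(`SmallDensity uniformProfile σ`), every family of flows, `τ > 0`, continuous `χ ≥ 0`, continuous `0 ≤ Ξ ≤ C`, `0 < r < 1/2` and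
`η, δ > 0`, eventually in `N`:
`G_N {z | Θ̄_Ξ ∫₀^τ∫χ + η < ∫₀^τ∫ χ(s, x) B_r Ξ (Φ_s z, x) dx ds} ≤ δ`, `Θ̄_Ξ = ∫ Θ Ξ d(N(u,θ) ⊗ N(u,θ))`. [folklore] -/
theorem pairFunctional_upper_inProb_rung0 {σ a θ : ℝ} {u : V3} (hsd : SmallDensity uniformProfile σ) (ha : 0 < a) (hθ : 0 < θ)
    (Φ : (N : ℕ) → HardSphereFlow (Torus.geometry (Fin 3)) (hsDiameter σ N) (N + 1)) {τ : ℝ} (hτ : 0 < τ)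
    {χ : ℝ × T3 → ℝ} (hχ : Continuous χ) (hχ0 : ∀ p, 0 ≤ χ p)
    {Ξ : V3 × V3 × V3 → ℝ} (hΞc : Continuous Ξ) (hΞ0 : ∀ q, 0 ≤ Ξ q) {C : ℝ} (hΞC : ∀ q, Ξ q ≤ C)
    {r : ℝ} (hr : 0 < r) (hr2 : r < 1 / 2) {η δ : ℝ} (hη : 0 < η) (hδ : 0 < δ) :
    ∃ N₀ : ℕ, ∀ N : ℕ, N₀ ≤ N →
      localGibbsLaw σ (fun _ => a) (fun _ => u) (fun _ => θ) N (Φ N)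
        {z | (∫ p, sphereMark Ξ p.1 p.2 ∂((gaussMeasure u θ).prod (gaussMeasure u θ))) *
              (∫ s in Icc (0 : ℝ) τ, ∫ x : T3, χ (s, x)) + η <
            ∫ s in Icc (0 : ℝ) τ, ∫ x : T3, χ (s, x) * pairFunctional r Ξ ((Φ N).flow s z) x} ≤ ENNReal.ofReal δ := by
  have hσ2 : σ ≤ 1 / 2 := hsd.σ_lt_half.le
  obtain ⟨Cχ, hCχ0, hχC⟩ := exists_bound_on_slab' χ hχ τ
  -- the target accuracy for the static `L¹` deviation
  obtain ⟨ε₀, hε₀def⟩ : ∃ ε₀ : ℝ, ε₀ = δ * η / (τ * (Cχ + 1)) := ⟨_, rfl⟩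
  have hε₀ : 0 < ε₀ := by rw [hε₀def]; positivity
  -- constants (kept literal so that the four-term bound is matched syntactically)
  have hM0 : 0 ≤ 3 / (Real.pi * r ^ 3) := by positivity
  have hS0 : 0 ≤ (sphereMeasure : Measure (Metric.sphere (0 : V3) 1)).real univ := measureReal_nonneg
  have hC0 : 0 ≤ C := (hΞ0 0).trans (hΞC 0)
  have hm₂0 : 0 ≤ ‖u‖ ^ 2 + 3 * θ := by positivity
  obtain ⟨X, hXdef⟩ : ∃ X : ℝ, X = (4 * (3 / (Real.pi * r ^ 3)) ^ 2 + 4) * C *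
      (sphereMeasure : Measure (Metric.sphere (0 : V3) 1)).real univ * (‖u‖ ^ 2 + 3 * θ) := ⟨_, rfl⟩
  have hX0 : 0 ≤ X := by rw [hXdef]; positivity
  -- the speed cutoff `L`
  obtain ⟨L, hLdef⟩ : ∃ L : ℝ, L = 4 * X / ε₀ + 1 := ⟨_, rfl⟩
  have hL0 : 0 < L := by rw [hLdef]; positivity
  have htail : 4 * (3 / (Real.pi * r ^ 3)) ^ 2 * (C * (sphereMeasure : Measure (Metric.sphere (0 : V3) 1)).real univ / L) *
      (‖u‖ ^ 2 + 3 * θ) + C * (sphereMeasure : Measure (Metric.sphere (0 : V3) 1)).real univ / L * (4 * (‖u‖ ^ 2 + 3 * θ)) ≤ ε₀ / 4 := by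
    have e : 4 * (3 / (Real.pi * r ^ 3)) ^ 2 * (C * (sphereMeasure : Measure (Metric.sphere (0 : V3) 1)).real univ / L) *
        (‖u‖ ^ 2 + 3 * θ) + C * (sphereMeasure : Measure (Metric.sphere (0 : V3) 1)).real univ / L * (4 * (‖u‖ ^ 2 + 3 * θ)) =
        X / L := by rw [hXdef]; field_simp
    rw [e, div_le_div_iff₀ hL0 (by norm_num : (0 : ℝ) < 4)]
    have : ε₀ * L = 4 * X + ε₀ := by rw [hLdef]; field_simp
    nlinarith
  -- `η₁, η₂`
  obtain ⟨η₁, hη₁def⟩ : ∃ η₁ : ℝ, η₁ = ε₀ / 4 := ⟨_, rfl⟩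
  have hη₁0 : 0 < η₁ := by rw [hη₁def]; positivity
  have hη₁half : η₁ / 2 = ε₀ / 8 := by rw [hη₁def]; ring
  have hCΘ0 : 0 ≤ C * (2 * L) * (sphereMeasure : Measure (Metric.sphere (0 : V3) 1)).real univ := by positivity
  obtain ⟨η₂, hη₂def⟩ : ∃ η₂ : ℝ, η₂ = ε₀ / (8 * (C * (2 * L) * (sphereMeasure : Measure (Metric.sphere (0 : V3) 1)).real univ *
      (3 / (Real.pi * r ^ 3) + 1) + 1)) := ⟨_, rfl⟩
  have hden : 0 < C * (2 * L) * (sphereMeasure : Measure (Metric.sphere (0 : V3) 1)).real univ * (3 / (Real.pi * r ^ 3) + 1) + 1 := by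
    positivity
  have hη₂0 : 0 < η₂ := by rw [hη₂def]; positivity
  have hT2 : C * (2 * L) * (sphereMeasure : Measure (Metric.sphere (0 : V3) 1)).real univ * (3 / (Real.pi * r ^ 3) + 1) * η₂ ≤
      ε₀ / 8 := by
    rw [hη₂def, ← mul_div_assoc, div_le_div_iff₀ (by positivity) (by norm_num : (0 : ℝ) < 8)]
    nlinarith [mul_nonneg hCΘ0 (by linarith : (0 : ℝ) ≤ 3 / (Real.pi * r ^ 3) + 1), hε₀.le]
  -- the `N`-remainder tends to `0`
  have hVlim : Tendsto (fun N : ℕ => ∫ xs, (empDensity r xs 0 - 1) ^ 2 ∂posGibbsMeasure (fun _ : T3 => a) (hsDiameter σ N) (N + 1))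
      atTop (𝓝 0) := tendsto_integral_sq_empDensity_sub_one hsd ha hr hr2 0
  have hRlim := tendsto_remainder hVlim (8 * (3 / (Real.pi * r ^ 3)) ^ 4 *
      (C * (2 * L) * (sphereMeasure : Measure (Metric.sphere (0 : V3) 1)).real univ) ^ 2)
    (C * (2 * L) * (sphereMeasure : Measure (Metric.sphere (0 : V3) 1)).real univ * (3 / (Real.pi * r ^ 3) + 1))
    (C * (2 * L) * (sphereMeasure : Measure (Metric.sphere (0 : V3) 1)).real univ * (3 / (Real.pi * r ^ 3)) ^ 2) η₁ η₂
  obtain ⟨N₀, hN₀⟩ := Filter.eventually_atTop.1 (hRlim.eventually (gt_mem_nhds (by positivity : (0 : ℝ) < ε₀ / 4)))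
  refine ⟨N₀, fun N hN => ?_⟩
  -- the static deviation at every base point is `≤ ε₀`
  have he : ∀ x₀ : T3, ∫ z, |pairFunctional r Ξ z x₀ - ∫ p, sphereMark Ξ p.1 p.2 ∂((gaussMeasure u θ).prod (gaussMeasure u θ))|
      ∂(localGibbsLaw σ (fun _ => a) (fun _ => u) (fun _ => θ) N (Φ N)) ≤ ε₀ := by
    intro x₀
    have h := integral_abs_pairFunctional_sub_le (u := u) hσ2 ha hθ hΞc hΞ0 hΞC hr x₀ N (Φ N) hL0 hη₁0 hη₂0
    rw [integral_sq_empDensity_sub_one_eq a (hsDiameter σ N) r (N + 1) x₀] at h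
    have hRN := hN₀ N hN
    have hRN' : 8 * (3 / (Real.pi * r ^ 3)) ^ 4 *
          (C * (2 * L) * (sphereMeasure : Measure (Metric.sphere (0 : V3) 1)).real univ) ^ 2 * (((N + 1 : ℕ) : ℝ))⁻¹ / (2 * η₁) +
        C * (2 * L) * (sphereMeasure : Measure (Metric.sphere (0 : V3) 1)).real univ * (3 / (Real.pi * r ^ 3) + 1) *
          ((∫ xs, (empDensity r xs 0 - 1) ^ 2 ∂posGibbsMeasure (fun _ : T3 => a) (hsDiameter σ N) (N + 1)) / (4 * η₂)) +
        C * (2 * L) * (sphereMeasure : Measure (Metric.sphere (0 : V3) 1)).real univ * (3 / (Real.pi * r ^ 3)) ^ 2 *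
          (((N + 1 : ℕ) : ℝ))⁻¹ < ε₀ / 4 := by
      simpa only [mul_assoc] using hRN
    exact h.trans (fourTerm_le_of_bounds hε₀.le htail hT2 hη₁half hRN')
  -- the Markov transfer along the flow
  have hmain := measure_timeIntegral_pairFunctional_gt_le (u := u) hσ2 ha hθ hΞc hΞ0 hΞC hr N (Φ N) hχ hχ0 hχC hτ hη he
  refine hmain.trans (ENNReal.ofReal_le_ofReal ?_)
  rw [hε₀def, div_le_iff₀ hη]
  have hC1 : 0 < Cχ + 1 := by linarith
  have e : τ * (Cχ * (δ * η / (τ * (Cχ + 1)))) = δ * η * (Cχ / (Cχ + 1)) := by field_simp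
  rw [e]
  have hfrac : Cχ / (Cχ + 1) ≤ 1 := (div_le_one hC1).2 (by linarith)
  nlinarith [mul_pos hδ hη]

/-- **Registered helper stub `stub_pairFunctionalUpperInProbRung0`** of crux stmt-AtomisticToContinuum-13080 (line `Sketch`, input of `stub_staticOpacityFloorRung0`),
closed signature form of the file's main result. [folklore] -/
theorem stub_pairFunctionalUpperInProbRung0 : ∀ (σ a θ : ℝ) (u : V3), SmallDensity uniformProfile σ → 0 < a → 0 < θ → ∀ (Φ : (N : ℕ) → HardSphereFlow (Torus.geometry (Fin 3)) (hsDiameter σ N) (N + 1)) (τ : ℝ), 0 < τ → ∀ (χ : ℝ × T3 → ℝ), Continuous χ → (∀ p, 0 ≤ χ p) → ∀ (Ξ : V3 × V3 × V3 → ℝ), Continuous Ξ → (∀ q, 0 ≤ Ξ q) → ∀ (C : ℝ), (∀ q, Ξ q ≤ C) → ∀ (r : ℝ), 0 < r → r < 1 / 2 → ∀ (η δ : ℝ), 0 < η → 0 < δ → ∃ N₀ : ℕ, ∀ N : ℕ, N₀ ≤ N → localGibbsLaw σ (fun _ => a) (fun _ => u) (fun _ => θ) N (Φ N) {z | (∫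 p, sphereMark Ξ p.1 p.2 ∂((gaussMeasure u θ).prod (gaussMeasure u θ))) * (∫ s in Set.Icc (0 : ℝ) τ, ∫ x : T3, χ (s, x)) + η < ∫ s in Set.Icc (0 : ℝ) τ, ∫ x : T3, χ (s, x) * pairFunctional r Ξ ((Φ N).flow s z) x} ≤ ENNReal.ofReal δ :=
  fun _σ _a _θ u hsd ha hθ Φ _τ hτ _χ hχ hχ0 _Ξ hΞc hΞ0 _C hΞC _r hr hr2 _η _δ hη hδ =>
    pairFunctional_upper_inProb_rung0 (u := u) hsd ha hθ Φ hτ hχ hχ0 hΞc hΞ0 hΞC hr hr2 hη hδ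

end RateFloorPairFunctionalUpper

end Summit.AtomisticToContinuum.HydrodynamicLimit.Theorems

end
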